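import Summits.RiemannHypothesis.RiemannHypothesis.Theorems.WeilGroundStateGroundStatesConvergeToXiRHofTightZero
import Summits.RiemannHypothesis.RiemannHypothesis.Theorems.WeilGroundStateGroundStatesConvergeToXiLineExactWeak
import Literature.Analysis.FunctionSpaces.PlancherelL1L2
import Literature.NumberTheory.LFunctions.RiemannXiProofs
import HarnessLib

/-!
# `WeilGroundState.GroundStatesConvergeToXi` — Plancherel bookkeeping on the critical line
(crux item stmt-RiemannHypothesis-1527, route route-RiemannHypothesis-WeilGroundState; line `Sketch`,
lead c3; `--supports`: preliminaries for the renormalisation blow-up theorem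
`…RenormBlowup.lean`)

The overlap `⟨u, φ_a⟩ = ∫ u φ_a` of a windowed `L²` function with the truncated Riemann kernel
`φ_a = Φ χ_a` is computed through the critical line: `∫ u φ_a = ∫ 𝓕u · 𝓕⁻φ_a` with
`𝓕u(ξ) = û(1/2 − 2πiξ)`, `𝓕⁻φ_a(ξ) = φ̂_a(1/2 + 2πiξ)`.  This file records, RH-free:

* `ξ` is real on the critical line, `ξ(1/2−iτ)ξ(1/2+iτ) = |ξ(1/2+iτ)|²`, `|ξ(1/2+iτ)| ≤ C_Ψ`;
* `𝓕Φ(ξ) = ξ(1/2 + 2πiξ)` and `∫ |ξ(1/2+2πiξ)|² dξ = ∫ |Φ|² > 0` (Plancherel);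
* `|𝓕⁻φ_a(ξ) − ξ(1/2+2πiξ)| ≤ D exp(−(π/4)e^{2(a−1)})/(1+(2πξ)²)` uniformly in `a ≥ 1`, and the
  resulting `L²`-tail bound `∫_{sᶜ} |𝓕⁻φ_a|² ≤ 2∫_{sᶜ}|ξ(1/2+2πi·)|² + 2π D² η(a)²`;
* two elementary integral inequalities: the AM–GM tail bound
  `|∫_s F G| ≤ (θ/2)∫|F|² + (1/2θ)∫_s|G|²` and the bulk bound `|∫_{[-R,R]}(f − g)| ≤ 2R·e`;
* locally uniform convergence on the strip gives uniform convergence of `c_k 𝓕u_k` on every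
  frequency window `[-R, R]`.
No new definitions.
-/

noncomputable section

set_option linter.dupNamespace false

open scoped Topology Real ComplexConjugate FourierTransform
open Filter Set MeasureTheory Complex

namespace Summit.RiemannHypothesis.RiemannHypothesis.Theorems.GroundStatesConvergeToXi

open Literature.NumberTheory.LFunctions

/-! ## `ξ` on the critical line -/

/-- `ξ` is real on the critical line (`Ξ` is real on the real axis). [folklore] -/
theorem riemannXi_criticalLine_im (τ : ℝ) : (riemannXi (1 / 2 + τ * I)).im = 0 := by
  have h := im_riemannXiUpper_ofReal_holds τ
  rw [riemannXiUpper, mul_comm] at h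
  exact h

/-- `ξ(1/2 − iτ) · ξ(1/2 + iτ) = |ξ(1/2 + iτ)|²` (evenness and reality of `Ξ`). [folklore] -/
theorem riemannXi_criticalLine_neg_mul (τ : ℝ) :
    riemannXi (1 / 2 + ((-τ : ℝ) : ℂ) * I) * riemannXi (1 / 2 + τ * I) =
      ((‖riemannXi (1 / 2 + τ * I)‖ ^ 2 : ℝ) : ℂ) := by
  rw [LagariasMontague.riemannXi_criticalLine_neg]
  set z := riemannXi (1 / 2 + τ * I) with hz
  have him : z.im = 0 := riemannXi_criticalLine_im τ
  have hre : z = ((z.re : ℝ) : ℂ) := by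
    apply Complex.ext <;> simp [him]
  rw [hre, Complex.norm_real, Real.norm_eq_abs, sq_abs]
  push_cast
  ring

/-- `ξ(1/2 + iτ)² = |ξ(1/2 + iτ)|²` on the critical line (reality of `Ξ`). [folklore] -/
theorem riemannXi_criticalLine_mul_self (τ : ℝ) :
    riemannXi (1 / 2 + τ * I) * riemannXi (1 / 2 + τ * I) =
      ((‖riemannXi (1 / 2 + τ * I)‖ ^ 2 : ℝ) : ℂ) := by
  rw [← riemannXi_criticalLine_neg_mul τ, LagariasMontague.riemannXi_criticalLine_neg]

/-- `0 ≤ C_Ψ`. [folklore] -/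
theorem fourierDecayConst_nonneg : 0 ≤ LagariasMontague.fourierDecayConst := by
  unfold LagariasMontague.fourierDecayConst
  have h1 : 0 ≤ ∫ u, ‖LagariasMontague.Psic u‖ := integral_nonneg fun _ => norm_nonneg _
  have h2 : 0 ≤ ∫ u, ‖deriv (deriv LagariasMontague.Psic) u‖ :=
    integral_nonneg fun _ => norm_nonneg _
  positivity

/-- `|ξ(1/2 + iτ)| ≤ C_Ψ` on the critical line. [folklore] -/
theorem norm_riemannXi_criticalLine_le (τ : ℝ) :
    ‖riemannXi (1 / 2 + τ * I)‖ ≤ LagariasMontague.fourierDecayConst := by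
  rw [LagariasMontague.riemannXi_criticalLine_eq_fourier]
  refine (LagariasMontague.norm_fourier_Psic_le _).trans ?_
  refine mul_le_of_le_one_right fourierDecayConst_nonneg ?_
  rw [inv_le_one_iff₀]
  right
  nlinarith [sq_nonneg (τ / (4 * π))]

/-! ## The Fourier dictionary for `Φ` and `φ_a` -/

/-- `𝓕Φ(ξ) = ξ(1/2 + 2πiξ)` (`𝓕Φ(ξ) = Φ̂(1/2 − 2πiξ)` and `Ξ` is even). [folklore] -/
theorem fourier_phi_eq (ξ : ℝ) :
    𝓕 (fun t : ℝ => (2 : ℂ) * LagariasMontague.Psic (2 * t)) ξ =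
      riemannXi (1 / 2 + ((2 * π * ξ : ℝ) : ℂ) * I) := by
  rw [Negative.fourier_eq_weilMellin, weilMellin_phi_criticalLine,
    show (-2 * π * ξ : ℝ) = -(2 * π * ξ) by ring, LagariasMontague.riemannXi_criticalLine_neg]

/-- **Plancherel for Riemann's kernel**: `∫ |ξ(1/2 + 2πiξ)|² dξ = ∫ |Φ|²`, and this is positive;
the integrand is integrable. [folklore] -/
theorem integral_norm_sq_riemannXi_eq_and_pos :
    Integrable (fun ξ : ℝ => ‖riemannXi (1 / 2 + ((2 * π * ξ : ℝ) : ℂ) * I)‖ ^ 2) ∧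
    (∫ ξ : ℝ, ‖riemannXi (1 / 2 + ((2 * π * ξ : ℝ) : ℂ) * I)‖ ^ 2) =
      ∫ t : ℝ, ‖(2 : ℂ) * LagariasMontague.Psic (2 * t)‖ ^ 2 ∧
    0 < ∫ ξ : ℝ, ‖riemannXi (1 / 2 + ((2 * π * ξ : ℝ) : ℂ) * I)‖ ^ 2 := by
  have h1 := Negative.integrable_phi
  have h2 := Negative.memLp_phi
  have hF := Literature.Analysis.FunctionSpaces.memLp_two_fourierIntegral h1 h2
  have hP := Literature.Analysis.FunctionSpaces.integral_norm_sq_fourierIntegral_eq h1 h2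
  have hfun : (fun ξ : ℝ => ‖𝓕 (fun t : ℝ => (2 : ℂ) * LagariasMontague.Psic (2 * t)) ξ‖ ^ 2) =
      fun ξ : ℝ => ‖riemannXi (1 / 2 + ((2 * π * ξ : ℝ) : ℂ) * I)‖ ^ 2 := by
    funext ξ; rw [fourier_phi_eq]
  have hi : Integrable (fun ξ : ℝ => ‖riemannXi (1 / 2 + ((2 * π * ξ : ℝ) : ℂ) * I)‖ ^ 2) := by
    rw [← hfun]; exact (memLp_two_iff_integrable_sq_norm hF.1).1 hF
  rw [hfun] at hP
  exact ⟨hi, hP, hP ▸ integral_phi_mul_phi_eq_and_pos.2⟩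

/-- **The inverse Fourier transform of the truncated kernel is uniformly close to `ξ` on the
line**: `|𝓕⁻φ_a(ξ) − ξ(1/2 + 2πiξ)| ≤ D exp(−(π/4)e^{2(a−1)})/(1 + (2πξ)²)` for `a ≥ 1`
(`𝓕⁻φ_a(ξ) = φ̂_a(1/2 + 2πiξ) = ξ − tail`, strip decay of the tail transform). [folklore] -/
theorem exists_norm_fourierInv_phiCut_sub_le :
    ∃ D : ℝ, 0 ≤ D ∧ ∀ a : ℝ, 1 ≤ a → ∀ ξ : ℝ,
      ‖𝓕⁻ (fun t : ℝ => (2 : ℂ) * LagariasMontague.Psic (2 * t) *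
          ((Literature.Analysis.Calculus.cutoff a t : ℝ) : ℂ)) ξ -
        riemannXi (1 / 2 + ((2 * π * ξ : ℝ) : ℂ) * I)‖ ≤
        D * Real.exp (-(π / 4 * Real.exp (2 * (a - 1)))) / (1 + (2 * π * ξ) ^ 2) := by
  obtain ⟨D, hD, hT⟩ := exists_norm_weilMellin_tail_le
  refine ⟨D, hD, fun a ha ξ => ?_⟩
  have hs0 : (0 : ℝ) ≤ (1 / 2 + ((2 * π * ξ : ℝ) : ℂ) * I).re := by simp
  have hs1 : (1 / 2 + ((2 * π * ξ : ℝ) : ℂ) * I).re ≤ 1 := by simp; norm_num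
  rw [Real.fourierInv_eq_fourier_neg, Negative.fourier_eq_weilMellin,
    show (-2 * π * -ξ : ℝ) = 2 * π * ξ by ring, weilMellin_phiCut_eq a hs0 hs1,
    sub_sub_cancel_left, norm_neg]
  have him : (1 / 2 + ((2 * π * ξ : ℝ) : ℂ) * I).im = 2 * π * ξ := by simp
  have h := hT a ha _ hs0 hs1
  rwa [him] at h

/-! ## Elementary integral inequalities -/

/-- **AM–GM tail bound**: `‖∫_s F G‖ ≤ (θ/2) ∫ ‖F‖² + (1/2θ) ∫_s ‖G‖²`. [folklore] -/
theorem norm_setIntegral_mul_le_of_sq {s : Set ℝ} {F G : ℝ → ℂ}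
    (hF2 : Integrable fun ξ => ‖F ξ‖ ^ 2) (hG2 : IntegrableOn (fun ξ => ‖G ξ‖ ^ 2) s)
    {θ : ℝ} (hθ : 0 < θ) :
    ‖∫ ξ in s, F ξ * G ξ‖ ≤ θ / 2 * (∫ ξ, ‖F ξ‖ ^ 2) + 1 / (2 * θ) * ∫ ξ in s, ‖G ξ‖ ^ 2 := by
  have hpt : ∀ ξ, ‖F ξ * G ξ‖ ≤ θ / 2 * ‖F ξ‖ ^ 2 + 1 / (2 * θ) * ‖G ξ‖ ^ 2 := by
    intro ξ
    rw [norm_mul]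
    have h := sq_nonneg (θ * ‖F ξ‖ - ‖G ξ‖)
    have e : θ / 2 * ‖F ξ‖ ^ 2 + 1 / (2 * θ) * ‖G ξ‖ ^ 2 - ‖F ξ‖ * ‖G ξ‖ =
        (θ * ‖F ξ‖ - ‖G ξ‖) ^ 2 / (2 * θ) := by
      field_simp
      ring
    have : 0 ≤ (θ * ‖F ξ‖ - ‖G ξ‖) ^ 2 / (2 * θ) := by positivity
    linarith
  calc ‖∫ ξ in s, F ξ * G ξ‖ ≤ ∫ ξ in s, ‖F ξ * G ξ‖ := norm_integral_le_integral_norm _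
    _ ≤ ∫ ξ in s, (θ / 2 * ‖F ξ‖ ^ 2 + 1 / (2 * θ) * ‖G ξ‖ ^ 2) :=
        integral_mono_of_nonneg (ae_of_all _ fun _ => norm_nonneg _)
          ((hF2.integrableOn.const_mul _).add (hG2.const_mul _)) (ae_of_all _ hpt)
    _ = θ / 2 * (∫ ξ in s, ‖F ξ‖ ^ 2) + 1 / (2 * θ) * ∫ ξ in s, ‖G ξ‖ ^ 2 := by
        rw [integral_add (hF2.integrableOn.const_mul _) (hG2.const_mul _), integral_const_mul,
          integral_const_mul]
    _ ≤ θ / 2 * (∫ ξ, ‖F ξ‖ ^ 2) + 1 / (2 * θ) * ∫ ξ in s, ‖G ξ‖ ^ 2 := by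
        have h := setIntegral_le_integral (s := s) hF2 (ae_of_all _ fun _ => by positivity)
        have hθ2 : 0 ≤ θ / 2 := by positivity
        nlinarith

/-- **Bulk bound**: on `[-R, R]`, `‖∫ f − ∫ g‖ ≤ 2R · e` when `‖f − g‖ ≤ e` pointwise. [folklore] -/
theorem norm_setIntegral_Icc_sub_le {R e : ℝ} (hR : 0 ≤ R) {f g : ℝ → ℂ}
    (hf : IntegrableOn f (Icc (-R) R)) (hg : IntegrableOn g (Icc (-R) R))
    (h : ∀ ξ ∈ Icc (-R) R, ‖f ξ - g ξ‖ ≤ e) :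
    ‖(∫ ξ in Icc (-R) R, f ξ) - ∫ ξ in Icc (-R) R, g ξ‖ ≤ 2 * R * e := by
  rw [← integral_sub hf hg]
  have hμ : volume (Icc (-R) R) < ⊤ := measure_Icc_lt_top
  refine (norm_setIntegral_le_of_norm_le_const hμ fun ξ hξ => h ξ hξ).trans (le_of_eq ?_)
  rw [measureReal_def, Real.volume_Icc, ENNReal.toReal_ofReal (by linarith)]
  ring

/-! ## The `L²`-tail of `𝓕⁻φ_a`, uniformly in the window -/

/-- **Tail bound for `𝓕⁻φ_a`**: for `a ≥ 1` and measurable `s`,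
`∫_{sᶜ} ‖𝓕⁻φ_a‖² ≤ 2 ∫_{sᶜ} |ξ(1/2+2πi·)|² + 2π (D η(a))²`, with `D` the constant of
`exists_norm_fourierInv_phiCut_sub_le` and `η(a) = exp(−(π/4)e^{2(a−1)})`; and `‖𝓕⁻φ_a‖²` is
integrable. [folklore] -/
theorem exists_setIntegral_norm_sq_fourierInv_phiCut_le :
    ∃ D : ℝ, 0 ≤ D ∧ ∀ a : ℝ, 1 ≤ a →
      Integrable (fun ξ : ℝ => ‖𝓕⁻ (fun t : ℝ => (2 : ℂ) * LagariasMontague.Psic (2 * t) *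
          ((Literature.Analysis.Calculus.cutoff a t : ℝ) : ℂ)) ξ‖ ^ 2) ∧
      (∀ ξ : ℝ, ‖𝓕⁻ (fun t : ℝ => (2 : ℂ) * LagariasMontague.Psic (2 * t) *
          ((Literature.Analysis.Calculus.cutoff a t : ℝ) : ℂ)) ξ‖ ≤
          LagariasMontague.fourierDecayConst + D) ∧
      ∀ s : Set ℝ, MeasurableSet s →
        ∫ ξ in sᶜ, ‖𝓕⁻ (fun t : ℝ => (2 : ℂ) * LagariasMontague.Psic (2 * t) *
            ((Literature.Analysis.Calculus.cutoff a t : ℝ) : ℂ)) ξ‖ ^ 2 ≤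
          2 * (∫ ξ in sᶜ, ‖riemannXi (1 / 2 + ((2 * π * ξ : ℝ) : ℂ) * I)‖ ^ 2) +
            2 * π * (D * Real.exp (-(π / 4 * Real.exp (2 * (a - 1))))) ^ 2 := by
  obtain ⟨D, hD, hsub⟩ := exists_norm_fourierInv_phiCut_sub_le
  obtain ⟨hgi, -, -⟩ := integral_norm_sq_riemannXi_eq_and_pos
  refine ⟨D, hD, fun a ha => ?_⟩
  set φ : ℝ → ℂ := fun t : ℝ => (2 : ℂ) * LagariasMontague.Psic (2 * t) *
    ((Literature.Analysis.Calculus.cutoff a t : ℝ) : ℂ) with hφ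
  set η : ℝ := Real.exp (-(π / 4 * Real.exp (2 * (a - 1)))) with hη
  set g : ℝ → ℝ := fun ξ => ‖riemannXi (1 / 2 + ((2 * π * ξ : ℝ) : ℂ) * I)‖ ^ 2 with hg
  have hη0 : 0 ≤ η := (Real.exp_pos _).le
  have hη1 : η ≤ 1 := by
    rw [hη]
    exact Real.exp_le_one_iff.2 (by
      have := Real.exp_pos (2 * (a - 1)); nlinarith [Real.pi_gt_three])
  -- pointwise: `‖𝓕⁻φ ξ‖² ≤ 2 g ξ + 2 (Dη)² (1 + ξ²)⁻¹`
  have hpt : ∀ ξ : ℝ, ‖𝓕⁻ φ ξ‖ ^ 2 ≤ 2 * g ξ + 2 * (D * η) ^ 2 * (1 + ξ ^ 2)⁻¹ := by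
    intro ξ
    have h1 := hsub a ha ξ
    have hq : 1 + ξ ^ 2 ≤ 1 + (2 * π * ξ) ^ 2 := by
      have : ξ ^ 2 ≤ (2 * π * ξ) ^ 2 := by
        rw [mul_pow]
        have h4 : (1 : ℝ) ≤ (2 * π) ^ 2 := by nlinarith [Real.pi_gt_three]
        nlinarith [sq_nonneg ξ]
      linarith
    have hpos : 0 < 1 + ξ ^ 2 := by positivity
    have h2 : ‖𝓕⁻ φ ξ - riemannXi (1 / 2 + ((2 * π * ξ : ℝ) : ℂ) * I)‖ ≤ D * η / (1 + ξ ^ 2) :=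
      h1.trans (div_le_div_of_nonneg_left (by positivity) hpos hq)
    have h3 : ‖𝓕⁻ φ ξ‖ ≤ ‖riemannXi (1 / 2 + ((2 * π * ξ : ℝ) : ℂ) * I)‖ + D * η / (1 + ξ ^ 2) := by
      have := norm_le_insert' (𝓕⁻ φ ξ) (riemannXi (1 / 2 + ((2 * π * ξ : ℝ) : ℂ) * I))
      linarith
    have h4 : 0 ≤ D * η / (1 + ξ ^ 2) := by positivity
    have h5 : 0 ≤ ‖riemannXi (1 / 2 + ((2 * π * ξ : ℝ) : ℂ) * I)‖ := norm_nonneg _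
    calc ‖𝓕⁻ φ ξ‖ ^ 2 ≤ (‖riemannXi (1 / 2 + ((2 * π * ξ : ℝ) : ℂ) * I)‖ + D * η / (1 + ξ ^ 2)) ^ 2 :=
          pow_le_pow_left₀ (norm_nonneg _) h3 2
      _ ≤ 2 * ‖riemannXi (1 / 2 + ((2 * π * ξ : ℝ) : ℂ) * I)‖ ^ 2 + 2 * (D * η / (1 + ξ ^ 2)) ^ 2 := by
          nlinarith [sq_nonneg (‖riemannXi (1 / 2 + ((2 * π * ξ : ℝ) : ℂ) * I)‖ - D * η / (1 + ξ ^ 2))]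
      _ ≤ 2 * g ξ + 2 * (D * η) ^ 2 * (1 + ξ ^ 2)⁻¹ := by
          rw [hg]
          simp only
          have h6 : (D * η / (1 + ξ ^ 2)) ^ 2 ≤ (D * η) ^ 2 * (1 + ξ ^ 2)⁻¹ := by
            rw [div_pow, div_eq_mul_inv]
            refine mul_le_mul_of_nonneg_left ?_ (by positivity)
            rw [inv_le_inv₀ (by positivity) hpos]
            nlinarith [sq_nonneg ξ]
          linarith
  -- global sup bound
  have hsup : ∀ ξ : ℝ, ‖𝓕⁻ φ ξ‖ ≤ LagariasMontague.fourierDecayConst + D := by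
    intro ξ
    have h1 := hsub a ha ξ
    have hpos : 0 < 1 + (2 * π * ξ) ^ 2 := by positivity
    have h2 : D * η / (1 + (2 * π * ξ) ^ 2) ≤ D := by
      rw [div_le_iff₀ hpos]
      nlinarith [sq_nonneg (2 * π * ξ), mul_nonneg hD hη0]
    have h3 := norm_riemannXi_criticalLine_le (2 * π * ξ)
    have h4 := norm_le_insert' (𝓕⁻ φ ξ) (riemannXi (1 / 2 + ((2 * π * ξ : ℝ) : ℂ) * I))
    linarith
  -- integrability of `‖𝓕⁻φ‖²`
  have hcont : Continuous (𝓕⁻ φ) := continuous_fourierInv_of_isWeilTest (isWeilTest_phiCut a)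
  have hmaj : Integrable fun ξ : ℝ => 2 * g ξ + 2 * (D * η) ^ 2 * (1 + ξ ^ 2)⁻¹ :=
    (hgi.const_mul 2).add (integrable_inv_one_add_sq.const_mul _)
  have hint : Integrable fun ξ : ℝ => ‖𝓕⁻ φ ξ‖ ^ 2 := by
    refine hmaj.mono' (hcont.norm.pow 2).aestronglyMeasurable (ae_of_all _ fun ξ => ?_)
    rw [Real.norm_eq_abs, abs_of_nonneg (by positivity)]
    exact hpt ξ
  refine ⟨hint, hsup, fun s hs => ?_⟩
  calc ∫ ξ in sᶜ, ‖𝓕⁻ φ ξ‖ ^ 2 ≤ ∫ ξ in sᶜ, (2 * g ξ + 2 * (D * η) ^ 2 * (1 + ξ ^ 2)⁻¹) :=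
        setIntegral_mono_on hint.integrableOn hmaj.integrableOn hs.compl fun ξ _ => hpt ξ
    _ = 2 * (∫ ξ in sᶜ, g ξ) + 2 * (D * η) ^ 2 * ∫ ξ in sᶜ, (1 + ξ ^ 2)⁻¹ := by
        rw [integral_add (hgi.const_mul 2).integrableOn (integrable_inv_one_add_sq.const_mul _).integrableOn,
          integral_const_mul, integral_const_mul]
    _ ≤ 2 * (∫ ξ in sᶜ, g ξ) + 2 * (D * η) ^ 2 * π := by
        have h1 : ∫ ξ in sᶜ, (1 + ξ ^ 2)⁻¹ ≤ π := by
          rw [← integral_univ_inv_one_add_sq]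
          exact setIntegral_le_integral integrable_inv_one_add_sq
            (ae_of_all _ fun ξ => by positivity)
        have h2 : 0 ≤ 2 * (D * η) ^ 2 := by positivity
        nlinarith
    _ = 2 * (∫ ξ in sᶜ, g ξ) + 2 * π * (D * η) ^ 2 := by ring

/-! ## Uniform convergence on frequency windows -/

/-- **Locally uniform convergence on the strip ⇒ uniform convergence of `c_k 𝓕u_k` on every
frequency window**: `sup_{|ξ| ≤ R} ‖c_k 𝓕u_k(ξ) − ξ(1/2 + 2πiξ)‖ → 0`
(`𝓕u_k(ξ) = û_k(1/2 − 2πiξ)`, the segment `{1/2 − 2πiξ : |ξ| ≤ R}` is a compact subset of the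
open strip, and `Ξ` is even). [folklore] -/
theorem eventually_norm_fourier_sub_riemannXi_lt {u : ℕ → ℝ → ℂ} {c : ℕ → ℂ}
    (hlim : TendstoLocallyUniformlyOn (fun k s => c k * weilMellin (u k) s) riemannXi atTop
      {s : ℂ | 0 < s.re ∧ s.re < 1}) (R : ℝ) {ε : ℝ} (hε : 0 < ε) :
    ∀ᶠ k in atTop, ∀ ξ ∈ Icc (-R) R,
      ‖c k * 𝓕 (u k) ξ - riemannXi (1 / 2 + ((2 * π * ξ : ℝ) : ℂ) * I)‖ < ε := by
  set γ : ℝ → ℂ := fun ξ => 1 / 2 + ((-2 * π * ξ : ℝ) : ℂ) * I with hγ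
  have hγc : Continuous γ := by
    rw [hγ]; fun_prop
  have hS : IsOpen {s : ℂ | 0 < s.re ∧ s.re < 1} :=
    (isOpen_lt continuous_const Complex.continuous_re).inter
      (isOpen_lt Complex.continuous_re continuous_const)
  have hK : IsCompact (γ '' Icc (-R) R) := isCompact_Icc.image hγc
  have hKS : γ '' Icc (-R) R ⊆ {s : ℂ | 0 < s.re ∧ s.re < 1} := by
    rintro _ ⟨ξ, -, rfl⟩
    exact criticalLine_mem_strip _
  have h1 : TendstoUniformlyOn (fun k s => c k * weilMellin (u k) s) riemannXi atTop
      (γ '' Icc (-R) R) :=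
    (tendstoLocallyUniformlyOn_iff_forall_isCompact hS).1 hlim _ hKS hK
  have h2 := Metric.tendstoUniformlyOn_iff.1 h1 ε hε
  filter_upwards [h2] with k hk ξ hξ
  have h3 := hk (γ ξ) (mem_image_of_mem γ hξ)
  rw [dist_eq_norm, norm_sub_rev] at h3
  rw [Negative.fourier_eq_weilMellin, show (2 * π * ξ : ℝ) = -(-2 * π * ξ) by ring,
    LagariasMontague.riemannXi_criticalLine_neg]
  exact h3

end Summit.RiemannHypothesis.RiemannHypothesis.Theorems.GroundStatesConvergeToXi

end
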